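import Mathlib
import Literature.Probability.Percolation.PercolationProofs
import Literature.Probability.LatticeModels.ProdBernoulliIndependence
import Literature.Probability.Percolation.KozmaNitzanPinning
import Summits.CriticalPhenomena.PercolationContinuityZ3.Theorems.PercNearOneGluingNearOneGluingKnLemma3i
import Summits.CriticalPhenomena.PercolationContinuityZ3.Theorems.PercNearOneGluingAdditiveGluingQuantLemma5
import HarnessLib

/-!
# `NoHeavyLowerTail` (stmt-CriticalPhenomena-4575), line fat-minority-linear — EXPLORATION GLUING with only the
# CLOSED explored pairs deleted (no sprinkling, no limit)

Route task `nh-dp-fatminority` (gen 4).  `μ = prodBernoulli w` on the pairs of `Fin n`.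

Companion of `…FatMinorityExplorationGluing` (comparison graph = ALL explored pairs deleted, `pinW w F ∅`) and
`…FatMinoritySharpSlack` (localised slack).  Here the comparison graph keeps the OPEN explored pairs at their original weights and
deletes only the CLOSED ones: for an explored leaf `L = {T closed} ∩ {O open}` with `O` joining the reached
vertex `c` to `o`, and `μ_T := prodBernoulli (pinW w T ∅)`,

  `μ_T(a ↔ b) ≤ μ_T(c ↔ b) + η  ⟹  μ(L ∩ {o ↮ b}) ≤ μ(L ∩ {a ↮ b}) + η μ(L)`     (`closedDeleted_notConn_le`),
  sharp form: `μ_T(a ↮ c) μ(L ∩ {o ↮ b}) ≤ μ_T(a ↮ c) μ(L ∩ {a ↮ b}) + η μ(L ∩ {a ↮ o})`  (`closedDeleted_notConn_le_sharp`).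

Proof: conditioning on `{T closed}` is pinning with the empty pattern (`prodBernoulli_real_inter_localCylinder`), and
`{O open}` is an increasing event determined by the open edge cluster of `c`, so KN Lemma 3(i) (`knLemma3i`, resp.
`knLemma3i_sharp` of `…AdditiveGluingQuantLemma5`) applies DIRECTLY in `μ_T` — no `ε`-sprinkling of the open pairs is needed when they are kept at
their weights.  Together with the all-deleted form this gives the two extreme comparison graphs `G ∖ (T ∪ O)` and
`G ∖ T` for the zero-slack moving anchor; the reached relay keeps its open pair in `G ∖ T`.  No new definitions.
-/

namespace Summit.CriticalPhenomena.PercolationContinuityZ3.Theorems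

open MeasureTheory Set
open Literature.Probability.LatticeModels (prodBernoulli)
open Literature.Probability.Percolation (BondConfig openConn openGraph openEdgeCluster)

noncomputable section
open Classical
open Literature.Probability.LatticeModels Literature.Probability.Percolation

variable {n : ℕ}

/-- The event "all pairs of `O` are open" is an up-set for the open-edge-cluster order at any vertex `c` such
that every pair of `O` lies in the open edge cluster of `c` whenever `O` is open (e.g. `O` a connected set of
pairs containing `c`). [folklore] -/
theorem allOpen_upClosure_of_subset_cluster (O : Finset (Sym2 (Fin n))) (c : Fin n)
    (hOc : ∀ ω : BondConfig (Fin n), (↑O : Set (Sym2 (Fin n))) ⊆ ω →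
      (↑O : Set (Sym2 (Fin n))) ⊆ openEdgeCluster ω c) :
    ∀ ω ω' : BondConfig (Fin n), ω ∈ {ω : BondConfig (Fin n) | (↑O : Set (Sym2 (Fin n))) ⊆ ω} →
      openEdgeCluster ω c ⊆ openEdgeCluster ω' c →
        ω' ∈ {ω : BondConfig (Fin n) | (↑O : Set (Sym2 (Fin n))) ⊆ ω} := by
  intro ω ω' hω hsub e he
  exact openEdgeCluster_subset ω' c (hsub (hOc ω hω he))

/-- **Exploration gluing, closed pairs deleted only.**  `T` (closed explored pairs) and `O` (open explored
pairs) finite (if they meet, `L` is empty), `L = {T closed} ∩ {O open}`; `O` lies in the open edge cluster of `c` whenever it is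
open, and on `L` the vertex `c` is joined to `o`.  If in `μ_T = prodBernoulli (pinW w T ∅)` (only the closed
explored pairs deleted) `μ_T(a ↔ b) ≤ μ_T(c ↔ b) + η`, `η ≥ 0`, then
`μ(L ∩ {o ↮ b}) ≤ μ(L ∩ {a ↮ b}) + η μ(L)`.
[cite: KozmaNitzan2024, Lemma 3(i) (p. 6) and §3.2 Lemma 5 (p. 13)] -/
theorem closedDeleted_notConn_le (w : Sym2 (Fin n) → unitInterval) (T O : Finset (Sym2 (Fin n)))
    (o a c b : Fin n) (η : ℝ) (hη : 0 ≤ η)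
    (hOc : ∀ ω : BondConfig (Fin n), (↑O : Set (Sym2 (Fin n))) ⊆ ω →
      (↑O : Set (Sym2 (Fin n))) ⊆ openEdgeCluster ω c)
    (hjoin : ∀ ω : BondConfig (Fin n), (↑O : Set (Sym2 (Fin n))) ⊆ ω → (openGraph ω).Reachable o c)
    (hle : (prodBernoulli (pinW w (↑T : Set (Sym2 (Fin n))) ∅)).real (openConn a b) ≤
      (prodBernoulli (pinW w (↑T : Set (Sym2 (Fin n))) ∅)).real (openConn c b) + η) :
    (prodBernoulli w).real
        ((localCylinder (↑T : Set (Sym2 (Fin n))) ∅ ∩ {ω | (↑O : Set (Sym2 (Fin n))) ⊆ ω}) ∩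
          (openConn o b)ᶜ) ≤
      (prodBernoulli w).real
        ((localCylinder (↑T : Set (Sym2 (Fin n))) ∅ ∩ {ω | (↑O : Set (Sym2 (Fin n))) ⊆ ω}) ∩
          (openConn a b)ᶜ) +
        η * (prodBernoulli w).real
          (localCylinder (↑T : Set (Sym2 (Fin n))) ∅ ∩ {ω | (↑O : Set (Sym2 (Fin n))) ⊆ ω}) := by
  set C : Set (BondConfig (Fin n)) := localCylinder (↑T : Set (Sym2 (Fin n))) ∅ with hC
  set Q : Set (BondConfig (Fin n)) := {ω | (↑O : Set (Sym2 (Fin n))) ⊆ ω} with hQdef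
  set μT := prodBernoulli (pinW w (↑T : Set (Sym2 (Fin n))) ∅) with hμT
  -- conditioning on `{T closed}` is pinning with the empty pattern
  have hcond : ∀ X : Set (BondConfig (Fin n)),
      (prodBernoulli w).real (C ∩ X) = (prodBernoulli w).real C * μT.real X := fun X => by
    rw [Set.inter_comm, hC, hμT]
    exact prodBernoulli_real_inter_localCylinder w T ∅ MeasurableSet.of_discrete
  -- KN Lemma 3(i) in `μT` with the increasing event `Q`
  have h3 := knLemma3i n (pinW w (↑T : Set (Sym2 (Fin n))) ∅) a c b Q η
    (allOpen_upClosure_of_subset_cluster O c hOc) hη hle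
  -- rewrite everything through the pinned law
  have e1 : ∀ X : Set (BondConfig (Fin n)), C ∩ Q ∩ X = C ∩ (X ∩ Q) := by
    intro X; ext ω; simp only [Set.mem_inter_iff]; tauto
  rw [e1, e1, hcond, hcond, hcond]
  have hC0 : 0 ≤ (prodBernoulli w).real C := measureReal_nonneg
  -- complements inside `Q` under `μT`
  have hsplit : ∀ X : Set (BondConfig (Fin n)),
      μT.real (Xᶜ ∩ Q) = μT.real Q - μT.real (X ∩ Q) := by
    intro X
    have h := measureReal_inter_add_sdiff (μ := μT) (s := Q) (t := X)
      (MeasurableSet.of_discrete : MeasurableSet X)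
    rw [Set.sdiff_eq, Set.inter_comm Q X, Set.inter_comm Q Xᶜ] at h
    linarith
  -- on `Q`, `{c ↔ b} ⊆ {o ↔ b}`
  have hsub : openConn c b ∩ Q ⊆ openConn o b ∩ Q := by
    rintro ω ⟨hcb, hωQ⟩
    exact ⟨SimpleGraph.Reachable.trans (hjoin ω hωQ) hcb, hωQ⟩
  have h1 : μT.real (openConn c b ∩ Q) ≤ μT.real (openConn o b ∩ Q) :=
    measureReal_mono hsub (measure_ne_top _ _)
  rw [hsplit (openConn o b), hsplit (openConn a b), ← mul_assoc, mul_comm η, mul_assoc, ← mul_add]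
  refine mul_le_mul_of_nonneg_left ?_ hC0
  linarith

/-- **Exploration gluing, closed pairs deleted only — localised slack.**  Same data; then
`μ_T(a ↮ c) · μ(L ∩ {o ↮ b}) ≤ μ_T(a ↮ c) · μ(L ∩ {a ↮ b}) + η · μ(L ∩ {a ↮ o})`: the slack is paid only on the
part of the leaf where the anchor is not joined to the observer (`knLemma3i_sharp` in `μ_T`).
[cite: KozmaNitzan2024, Lemma 3(i) (p. 6)] -/
theorem closedDeleted_notConn_le_sharp (w : Sym2 (Fin n) → unitInterval) (T O : Finset (Sym2 (Fin n)))
    (o a c b : Fin n) (η : ℝ) (hη : 0 ≤ η)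
    (hOc : ∀ ω : BondConfig (Fin n), (↑O : Set (Sym2 (Fin n))) ⊆ ω →
      (↑O : Set (Sym2 (Fin n))) ⊆ openEdgeCluster ω c)
    (hjoin : ∀ ω : BondConfig (Fin n), (↑O : Set (Sym2 (Fin n))) ⊆ ω → (openGraph ω).Reachable o c)
    (hle : (prodBernoulli (pinW w (↑T : Set (Sym2 (Fin n))) ∅)).real (openConn a b) ≤
      (prodBernoulli (pinW w (↑T : Set (Sym2 (Fin n))) ∅)).real (openConn c b) + η) :
    (prodBernoulli (pinW w (↑T : Set (Sym2 (Fin n))) ∅)).real (openConn a c)ᶜ *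
        (prodBernoulli w).real
          ((localCylinder (↑T : Set (Sym2 (Fin n))) ∅ ∩ {ω | (↑O : Set (Sym2 (Fin n))) ⊆ ω}) ∩
            (openConn o b)ᶜ) ≤
      (prodBernoulli (pinW w (↑T : Set (Sym2 (Fin n))) ∅)).real (openConn a c)ᶜ *
        (prodBernoulli w).real
          ((localCylinder (↑T : Set (Sym2 (Fin n))) ∅ ∩ {ω | (↑O : Set (Sym2 (Fin n))) ⊆ ω}) ∩
            (openConn a b)ᶜ) +
      η * (prodBernoulli w).real
          ((localCylinder (↑T : Set (Sym2 (Fin n))) ∅ ∩ {ω | (↑O : Set (Sym2 (Fin n))) ⊆ ω}) ∩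
            (openConn a o)ᶜ) := by
  set C : Set (BondConfig (Fin n)) := localCylinder (↑T : Set (Sym2 (Fin n))) ∅ with hC
  set Q : Set (BondConfig (Fin n)) := {ω | (↑O : Set (Sym2 (Fin n))) ⊆ ω} with hQdef
  set μT := prodBernoulli (pinW w (↑T : Set (Sym2 (Fin n))) ∅) with hμT
  set m := μT.real (openConn a c)ᶜ with hm
  have hm0 : 0 ≤ m := measureReal_nonneg
  have hcond : ∀ X : Set (BondConfig (Fin n)),
      (prodBernoulli w).real (C ∩ X) = (prodBernoulli w).real C * μT.real X := fun X => by
    rw [Set.inter_comm, hC, hμT]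
    exact prodBernoulli_real_inter_localCylinder w T ∅ MeasurableSet.of_discrete
  have h3 := knLemma3i_sharp (pinW w (↑T : Set (Sym2 (Fin n))) ∅) a c b Q η
    (allOpen_upClosure_of_subset_cluster O c hOc) hη hle
  have e1 : ∀ X : Set (BondConfig (Fin n)), C ∩ Q ∩ X = C ∩ (X ∩ Q) := by
    intro X; ext ω; simp only [Set.mem_inter_iff]; tauto
  rw [e1, e1, e1, hcond, hcond, hcond]
  have hC0 : 0 ≤ (prodBernoulli w).real C := measureReal_nonneg
  have hsplit : ∀ X : Set (BondConfig (Fin n)),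
      μT.real (Xᶜ ∩ Q) = μT.real Q - μT.real (X ∩ Q) := by
    intro X
    have h := measureReal_inter_add_sdiff (μ := μT) (s := Q) (t := X)
      (MeasurableSet.of_discrete : MeasurableSet X)
    rw [Set.sdiff_eq, Set.inter_comm Q X, Set.inter_comm Q Xᶜ] at h
    linarith
  have hsub : openConn c b ∩ Q ⊆ openConn o b ∩ Q := by
    rintro ω ⟨hcb, hωQ⟩
    exact ⟨SimpleGraph.Reachable.trans (hjoin ω hωQ) hcb, hωQ⟩
  have h1 : μT.real (openConn c b ∩ Q) ≤ μT.real (openConn o b ∩ Q) :=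
    measureReal_mono hsub (measure_ne_top _ _)
  -- on `Q`, `{a ↮ c} ⊆ {a ↮ o}`
  have hac : (openConn a c)ᶜ ∩ Q ⊆ (openConn a o)ᶜ ∩ Q := by
    rintro ω ⟨hω, hωQ⟩
    exact ⟨fun hao => hω (SimpleGraph.Reachable.trans hao (hjoin ω hωQ)), hωQ⟩
  have h2 : μT.real ((openConn a c)ᶜ ∩ Q) ≤ μT.real ((openConn a o)ᶜ ∩ Q) :=
    measureReal_mono hac (measure_ne_top _ _)
  rw [hsplit (openConn o b), hsplit (openConn a b)]
  have h4 : m * (μT.real Q - μT.real (openConn o b ∩ Q)) ≤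
      m * (μT.real Q - μT.real (openConn a b ∩ Q)) + η * μT.real ((openConn a o)ᶜ ∩ Q) := by
    have h5 := mul_le_mul_of_nonneg_left h1 hm0
    have h6 := mul_le_mul_of_nonneg_left h2 hη
    nlinarith [h3, h5, h6]
  have h7 := mul_le_mul_of_nonneg_left h4 hC0
  have e2 : m * ((prodBernoulli w).real C * (μT.real Q - μT.real (openConn o b ∩ Q))) =
      (prodBernoulli w).real C * (m * (μT.real Q - μT.real (openConn o b ∩ Q))) := by ring
  have e3 : m * ((prodBernoulli w).real C * (μT.real Q - μT.real (openConn a b ∩ Q))) +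
      η * ((prodBernoulli w).real C * μT.real ((openConn a o)ᶜ ∩ Q)) =
      (prodBernoulli w).real C * (m * (μT.real Q - μT.real (openConn a b ∩ Q)) +
        η * μT.real ((openConn a o)ᶜ ∩ Q)) := by ring
  rw [e2, e3]
  exact h7

end

end Summit.CriticalPhenomena.PercolationContinuityZ3.Theorems
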